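import Summits.Ventures.DiscreteObjects.PP12.OrderElevenTriangle
import Summits.Ventures.DiscreteObjects.PP12.OrderElevenCollineation

/-!
# PP(12), order-11 cell, Case B (triangle): the frame and the plane's `TriangleData 11` (kernel; definitions)
Framing: lottery ticket; floor = certified bounds/negative ranges.

Cell pub-namedobj (venture DiscreteObjects), target (M), designs gen 16. Setting: a projective plane of order 12, a collineation `σ` with
`σ¹¹ = 1` every fixed line of which carries exactly two fixed points (Case B of `PrimeOrderStructure.order12_q11_axis_or_two`); by
`OrderElevenTriangle` the fixed structure is a triangle. This file fixes the FRAME of FAMILY-B1P §3 / `OrderElevenCollineation.TriangleData`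
and defines the plane's data:
* vertices `v0, v1, v2` (`tv0/tv1/tv2`), sides `S_k` = the side opposite `v_k` (`sd0 = v1v2`, `sd1 = v0v2`, `sd2 = v0v1`); every fixed point
  is a vertex, every fixed line a side (`side_of_fixed`);
* base side points `Q_k ∈ S_k` (`sq0/sq1/sq2`, non-vertices) and pencil base lines `M_k = v_k Q_k` (`pm0/pm1/pm2`);
* `freePts` (points on no side), `freeLns` (lines through no vertex), the base free points **`P_t = M_0 ∩ σ^{−t} M_1`** (`fp11 t`, `t : Fin 11`; so `σ^t P_t ∈ M_1`), the free base
  lines `B_s` (`fb11 s`, `s : Fin 11 ≃` lines through `Q_0` other than `S_0, M_0`);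
* by the regularity lemmas of `OrderElevenTriangle` the exponents `phi t` (`σ^{phi t} P_t ∈ M_2`), `g1 s`, `g2 s` (`σ^{g_k s} Q_k ∈ B_s`)
  exist (`phiN11`, `g1N11`, `g2N11`);
* **`triData11 : TriangleData 11`** with `mem s t x ↔ σ^x P_t ∈ B_s`.
Its validity (`TriangleData.Valid`) is proved in `OrderElevenTriangleValid`. Nothing here asserts any census statement. No `sorry`, no new axioms.
-/

namespace Summit.Ventures.DiscreteObjects.PP12

open Configuration Finset
open scoped Classical

namespace Collineation

variable {P L : Type*} [Membership P L] (σ : Collineation P L) [ProjectivePlane P L] [Fintype P] [Fintype L]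

section ElevenB

variable (h12 : ProjectivePlane.order P L = 12) (hq : σ.onPoints ^ 11 = 1)
  (hB : ∀ l : L, σ.onLines l = l → ∀ [DecidablePred (· ∈ l)], σ.fixedOnLine l = 2)

/-! ### Vertices and sides -/

/-- vertex `v0` -/
noncomputable def tv0 : P := (σ.triangle_of_two_on_fixed_lines h12 hq hB).choose
/-- the remaining data after choosing `v0` -/
theorem tv0_spec : ∃ b c : P, σ.onPoints (σ.tv0 h12 hq hB) = σ.tv0 h12 hq hB ∧ σ.onPoints b = b ∧ σ.onPoints c = c ∧
    σ.tv0 h12 hq hB ≠ b ∧ σ.tv0 h12 hq hB ≠ c ∧ b ≠ c ∧ (∀ m : L, σ.tv0 h12 hq hB ∈ m → b ∈ m → c ∉ m) ∧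
    ∀ p : P, σ.onPoints p = p → p = σ.tv0 h12 hq hB ∨ p = b ∨ p = c :=
  (σ.triangle_of_two_on_fixed_lines h12 hq hB).choose_spec
/-- vertex `v1` -/
noncomputable def tv1 : P := (σ.tv0_spec h12 hq hB).choose
/-- the remaining data after choosing `v0, v1` -/
theorem tv1_spec : ∃ c : P, σ.onPoints (σ.tv0 h12 hq hB) = σ.tv0 h12 hq hB ∧ σ.onPoints (σ.tv1 h12 hq hB) = σ.tv1 h12 hq hB ∧
    σ.onPoints c = c ∧ σ.tv0 h12 hq hB ≠ σ.tv1 h12 hq hB ∧ σ.tv0 h12 hq hB ≠ c ∧ σ.tv1 h12 hq hB ≠ c ∧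
    (∀ m : L, σ.tv0 h12 hq hB ∈ m → σ.tv1 h12 hq hB ∈ m → c ∉ m) ∧
    ∀ p : P, σ.onPoints p = p → p = σ.tv0 h12 hq hB ∨ p = σ.tv1 h12 hq hB ∨ p = c :=
  (σ.tv0_spec h12 hq hB).choose_spec
/-- vertex `v2` -/
noncomputable def tv2 : P := (σ.tv1_spec h12 hq hB).choose
/-- **the triangle**: all facts about `v0, v1, v2` -/
theorem tv_spec : σ.onPoints (σ.tv0 h12 hq hB) = σ.tv0 h12 hq hB ∧ σ.onPoints (σ.tv1 h12 hq hB) = σ.tv1 h12 hq hB ∧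
    σ.onPoints (σ.tv2 h12 hq hB) = σ.tv2 h12 hq hB ∧ σ.tv0 h12 hq hB ≠ σ.tv1 h12 hq hB ∧ σ.tv0 h12 hq hB ≠ σ.tv2 h12 hq hB ∧
    σ.tv1 h12 hq hB ≠ σ.tv2 h12 hq hB ∧ (∀ m : L, σ.tv0 h12 hq hB ∈ m → σ.tv1 h12 hq hB ∈ m → σ.tv2 h12 hq hB ∉ m) ∧
    ∀ p : P, σ.onPoints p = p → p = σ.tv0 h12 hq hB ∨ p = σ.tv1 h12 hq hB ∨ p = σ.tv2 h12 hq hB :=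
  (σ.tv1_spec h12 hq hB).choose_spec

/-- side `S_0 = v1 v2` (opposite `v0`) -/
noncomputable def sd0 : L := HasLines.mkLine (σ.tv_spec h12 hq hB).2.2.2.2.2.1
/-- side `S_1 = v0 v2` (opposite `v1`) -/
noncomputable def sd1 : L := HasLines.mkLine (σ.tv_spec h12 hq hB).2.2.2.2.1
/-- side `S_2 = v0 v1` (opposite `v2`) -/
noncomputable def sd2 : L := HasLines.mkLine (σ.tv_spec h12 hq hB).2.2.2.1

/-- incidences of vertices and sides -/
theorem tv_mem_sd : σ.tv1 h12 hq hB ∈ σ.sd0 h12 hq hB ∧ σ.tv2 h12 hq hB ∈ σ.sd0 h12 hq hB ∧ σ.tv0 h12 hq hB ∈ σ.sd1 h12 hq hB ∧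
    σ.tv2 h12 hq hB ∈ σ.sd1 h12 hq hB ∧ σ.tv0 h12 hq hB ∈ σ.sd2 h12 hq hB ∧ σ.tv1 h12 hq hB ∈ σ.sd2 h12 hq hB :=
  ⟨(HasLines.mkLine_ax _).1, (HasLines.mkLine_ax _).2, (HasLines.mkLine_ax _).1, (HasLines.mkLine_ax _).2, (HasLines.mkLine_ax _).1,
    (HasLines.mkLine_ax _).2⟩

/-- `v0 ∉ S_0` -/
theorem tv0_not_mem_sd0 : σ.tv0 h12 hq hB ∉ σ.sd0 h12 hq hB := fun h =>
  (σ.tv_spec h12 hq hB).2.2.2.2.2.2.1 _ h (σ.tv_mem_sd h12 hq hB).1 (σ.tv_mem_sd h12 hq hB).2.1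
/-- `v1 ∉ S_1` -/
theorem tv1_not_mem_sd1 : σ.tv1 h12 hq hB ∉ σ.sd1 h12 hq hB := fun h =>
  (σ.tv_spec h12 hq hB).2.2.2.2.2.2.1 _ (σ.tv_mem_sd h12 hq hB).2.2.1 h (σ.tv_mem_sd h12 hq hB).2.2.2.1
/-- `v2 ∉ S_2` -/
theorem tv2_not_mem_sd2 : σ.tv2 h12 hq hB ∉ σ.sd2 h12 hq hB := fun h =>
  (σ.tv_spec h12 hq hB).2.2.2.2.2.2.1 _ (σ.tv_mem_sd h12 hq hB).2.2.2.2.1 (σ.tv_mem_sd h12 hq hB).2.2.2.2.2 h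

/-- `S_0 ∩ S_1 = {v2}` -/
theorem eq_tv2_of_mem_sd0_sd1 {p : P} (h0 : p ∈ σ.sd0 h12 hq hB) (h1 : p ∈ σ.sd1 h12 hq hB) : p = σ.tv2 h12 hq hB := by
  by_contra hne
  have e := (Nondegenerate.eq_or_eq h0 (σ.tv_mem_sd h12 hq hB).2.1 h1 (σ.tv_mem_sd h12 hq hB).2.2.2.1).resolve_left hne
  exact σ.tv0_not_mem_sd0 h12 hq hB (e ▸ (σ.tv_mem_sd h12 hq hB).2.2.1)
/-- `S_0 ∩ S_2 = {v1}` -/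
theorem eq_tv1_of_mem_sd0_sd2 {p : P} (h0 : p ∈ σ.sd0 h12 hq hB) (h2 : p ∈ σ.sd2 h12 hq hB) : p = σ.tv1 h12 hq hB := by
  by_contra hne
  have e := (Nondegenerate.eq_or_eq h0 (σ.tv_mem_sd h12 hq hB).1 h2 (σ.tv_mem_sd h12 hq hB).2.2.2.2.2).resolve_left hne
  exact σ.tv0_not_mem_sd0 h12 hq hB (e ▸ (σ.tv_mem_sd h12 hq hB).2.2.2.2.1)
/-- `S_1 ∩ S_2 = {v0}` -/
theorem eq_tv0_of_mem_sd1_sd2 {p : P} (h1 : p ∈ σ.sd1 h12 hq hB) (h2 : p ∈ σ.sd2 h12 hq hB) : p = σ.tv0 h12 hq hB := by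
  by_contra hne
  have e := (Nondegenerate.eq_or_eq h1 (σ.tv_mem_sd h12 hq hB).2.2.1 h2 (σ.tv_mem_sd h12 hq hB).2.2.2.2.1).resolve_left hne
  exact σ.tv1_not_mem_sd1 h12 hq hB (e ▸ (σ.tv_mem_sd h12 hq hB).2.2.2.2.2)

/-- the sides are fixed lines -/
theorem sd_fixed : σ.onLines (σ.sd0 h12 hq hB) = σ.sd0 h12 hq hB ∧ σ.onLines (σ.sd1 h12 hq hB) = σ.sd1 h12 hq hB ∧
    σ.onLines (σ.sd2 h12 hq hB) = σ.sd2 h12 hq hB :=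
  ⟨σ.line_fixed_of_two_fixed (σ.tv_mem_sd h12 hq hB).1 (σ.tv_mem_sd h12 hq hB).2.1 (σ.tv_spec h12 hq hB).2.2.2.2.2.1
      (σ.tv_spec h12 hq hB).2.1 (σ.tv_spec h12 hq hB).2.2.1,
    σ.line_fixed_of_two_fixed (σ.tv_mem_sd h12 hq hB).2.2.1 (σ.tv_mem_sd h12 hq hB).2.2.2.1 (σ.tv_spec h12 hq hB).2.2.2.2.1
      (σ.tv_spec h12 hq hB).1 (σ.tv_spec h12 hq hB).2.2.1,
    σ.line_fixed_of_two_fixed (σ.tv_mem_sd h12 hq hB).2.2.2.2.1 (σ.tv_mem_sd h12 hq hB).2.2.2.2.2 (σ.tv_spec h12 hq hB).2.2.2.1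
      (σ.tv_spec h12 hq hB).1 (σ.tv_spec h12 hq hB).2.1⟩

/-- **every fixed line is a side** -/
theorem side_of_fixed {m : L} (hm : σ.onLines m = m) : m = σ.sd0 h12 hq hB ∨ m = σ.sd1 h12 hq hB ∨ m = σ.sd2 h12 hq hB := by
  have T := σ.tv_spec h12 hq hB
  have M := σ.tv_mem_sd h12 hq hB
  rcases σ.fixed_line_through_two_of_three hB T.2.2.2.2.2.2.2 hm with ⟨ha, hb⟩ | ⟨hb, hc⟩ | ⟨ha, hc⟩
  · exact Or.inr (Or.inr ((Nondegenerate.eq_or_eq ha hb M.2.2.2.2.1 M.2.2.2.2.2).resolve_left T.2.2.2.1))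
  · exact Or.inl ((Nondegenerate.eq_or_eq hb hc M.1 M.2.1).resolve_left T.2.2.2.2.2.1)
  · exact Or.inr (Or.inl ((Nondegenerate.eq_or_eq ha hc M.2.2.1 M.2.2.2.1).resolve_left T.2.2.2.2.1))

omit [ProjectivePlane P L] [Fintype P] [Fintype L] in
include hq in
/-- powers `σ^k`, `11 ∤ k`, have the same fixed points … -/
theorem fixed_of_pow_fixed {k : ℕ} (hk : ¬ 11 ∣ k) {p : P} (hp : (σ.onPoints ^ k) p = p) : σ.onPoints p = p :=
  apply_eq_self_of_pow_apply_eq_self σ.onPoints (by norm_num) hq hk hp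

include hq in
/-- … and the same fixed lines -/
theorem lfixed_of_pow_lfixed {k : ℕ} (hk : ¬ 11 ∣ k) {m : L} (hm : (σ.onLines ^ k) m = m) : σ.onLines m = m :=
  apply_eq_self_of_pow_apply_eq_self σ.onLines (by norm_num) (σ.onLines_pow_eq_one hq) hk hm

/-! ### Free points and lines -/

/-- **the free points**: points on no side (they fall into regular orbits off the triangle) -/
noncomputable def freePts : Finset P := univ.filter fun p : P => p ∉ σ.sd0 h12 hq hB ∧ p ∉ σ.sd1 h12 hq hB ∧ p ∉ σ.sd2 h12 hq hB

/-- **the free lines**: lines through no vertex -/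
noncomputable def freeLns : Finset L := univ.filter fun m : L => σ.tv0 h12 hq hB ∉ m ∧ σ.tv1 h12 hq hB ∉ m ∧ σ.tv2 h12 hq hB ∉ m

/-- membership in `freePts` -/
theorem mem_freePts (p : P) : p ∈ σ.freePts h12 hq hB ↔ p ∉ σ.sd0 h12 hq hB ∧ p ∉ σ.sd1 h12 hq hB ∧ p ∉ σ.sd2 h12 hq hB := by
  simp [freePts]

/-- membership in `freeLns` -/
theorem mem_freeLns (m : L) : m ∈ σ.freeLns h12 hq hB ↔ σ.tv0 h12 hq hB ∉ m ∧ σ.tv1 h12 hq hB ∉ m ∧ σ.tv2 h12 hq hB ∉ m := by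
  simp [freeLns]

/-- free points are moved by every `σ^k`, `11 ∤ k` -/
theorem pow_apply_ne_of_free {k : ℕ} (hk : ¬ 11 ∣ k) {p : P} (hp : p ∈ σ.freePts h12 hq hB) : (σ.onPoints ^ k) p ≠ p := fun h => by
  rw [mem_freePts] at hp
  rcases (σ.tv_spec h12 hq hB).2.2.2.2.2.2.2 p (σ.fixed_of_pow_fixed hq hk h) with rfl | rfl | rfl
  · exact hp.2.1 (σ.tv_mem_sd h12 hq hB).2.2.1
  · exact hp.1 (σ.tv_mem_sd h12 hq hB).1
  · exact hp.1 (σ.tv_mem_sd h12 hq hB).2.1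

/-- `freePts` is invariant under powers -/
theorem pow_mem_freePts_iff (k : ℕ) (p : P) : (σ.onPoints ^ k) p ∈ σ.freePts h12 hq hB ↔ p ∈ σ.freePts h12 hq hB := by
  have F := σ.sd_fixed h12 hq hB
  have e : ∀ {m : L}, σ.onLines m = m → ((σ.onPoints ^ k) p ∈ m ↔ p ∈ m) := fun {m} hm => by
    conv_lhs => rw [← Equiv.Perm.pow_apply_eq_self_of_apply_eq_self hm k]
    exact σ.pow_mem_iff k p m
  simp only [mem_freePts, e F.1, e F.2.1, e F.2.2]

/-- free lines are moved by every `σ^k`, `11 ∤ k` -/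
theorem pow_apply_ne_of_lnFree {k : ℕ} (hk : ¬ 11 ∣ k) {m : L} (hm : m ∈ σ.freeLns h12 hq hB) : (σ.onLines ^ k) m ≠ m := fun h => by
  rw [mem_freeLns] at hm
  rcases σ.side_of_fixed h12 hq hB (σ.lfixed_of_pow_lfixed hq hk h) with rfl | rfl | rfl
  · exact hm.2.1 (σ.tv_mem_sd h12 hq hB).1
  · exact hm.1 (σ.tv_mem_sd h12 hq hB).2.2.1
  · exact hm.1 (σ.tv_mem_sd h12 hq hB).2.2.2.2.1

/-! ### Base side points `Q_k` and pencil base lines `M_k` -/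

/-- `Q_0 ∈ S_0`, not a vertex -/
noncomputable def sq0 : P := (exists_mem_ne_ne (σ.sd0 h12 hq hB) (σ.tv1 h12 hq hB) (σ.tv2 h12 hq hB)).choose
/-- `Q_1 ∈ S_1`, not a vertex -/
noncomputable def sq1 : P := (exists_mem_ne_ne (σ.sd1 h12 hq hB) (σ.tv0 h12 hq hB) (σ.tv2 h12 hq hB)).choose
/-- `Q_2 ∈ S_2`, not a vertex -/
noncomputable def sq2 : P := (exists_mem_ne_ne (σ.sd2 h12 hq hB) (σ.tv0 h12 hq hB) (σ.tv1 h12 hq hB)).choose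
/-- `Q_0 ∈ S_0`, `Q_0 ≠ v1, v2` -/
theorem sq0_spec : σ.sq0 h12 hq hB ∈ σ.sd0 h12 hq hB ∧ σ.sq0 h12 hq hB ≠ σ.tv1 h12 hq hB ∧ σ.sq0 h12 hq hB ≠ σ.tv2 h12 hq hB :=
  (exists_mem_ne_ne (σ.sd0 h12 hq hB) (σ.tv1 h12 hq hB) (σ.tv2 h12 hq hB)).choose_spec
/-- `Q_1 ∈ S_1`, `Q_1 ≠ v0, v2` -/
theorem sq1_spec : σ.sq1 h12 hq hB ∈ σ.sd1 h12 hq hB ∧ σ.sq1 h12 hq hB ≠ σ.tv0 h12 hq hB ∧ σ.sq1 h12 hq hB ≠ σ.tv2 h12 hq hB :=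
  (exists_mem_ne_ne (σ.sd1 h12 hq hB) (σ.tv0 h12 hq hB) (σ.tv2 h12 hq hB)).choose_spec
/-- `Q_2 ∈ S_2`, `Q_2 ≠ v0, v1` -/
theorem sq2_spec : σ.sq2 h12 hq hB ∈ σ.sd2 h12 hq hB ∧ σ.sq2 h12 hq hB ≠ σ.tv0 h12 hq hB ∧ σ.sq2 h12 hq hB ≠ σ.tv1 h12 hq hB :=
  (exists_mem_ne_ne (σ.sd2 h12 hq hB) (σ.tv0 h12 hq hB) (σ.tv1 h12 hq hB)).choose_spec

/-- `v_k ≠ Q_k` -/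
theorem tv_ne_sq : σ.tv0 h12 hq hB ≠ σ.sq0 h12 hq hB ∧ σ.tv1 h12 hq hB ≠ σ.sq1 h12 hq hB ∧ σ.tv2 h12 hq hB ≠ σ.sq2 h12 hq hB :=
  ⟨fun h => σ.tv0_not_mem_sd0 h12 hq hB (h ▸ (σ.sq0_spec h12 hq hB).1),
    fun h => σ.tv1_not_mem_sd1 h12 hq hB (h ▸ (σ.sq1_spec h12 hq hB).1),
    fun h => σ.tv2_not_mem_sd2 h12 hq hB (h ▸ (σ.sq2_spec h12 hq hB).1)⟩

/-- `M_0 = v0 Q_0` -/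
noncomputable def pm0 : L := HasLines.mkLine (σ.tv_ne_sq h12 hq hB).1
/-- `M_1 = v1 Q_1` -/
noncomputable def pm1 : L := HasLines.mkLine (σ.tv_ne_sq h12 hq hB).2.1
/-- `M_2 = v2 Q_2` -/
noncomputable def pm2 : L := HasLines.mkLine (σ.tv_ne_sq h12 hq hB).2.2

/-- incidences of `v_k, Q_k` with `M_k` -/
theorem pm_mem : σ.tv0 h12 hq hB ∈ σ.pm0 h12 hq hB ∧ σ.sq0 h12 hq hB ∈ σ.pm0 h12 hq hB ∧ σ.tv1 h12 hq hB ∈ σ.pm1 h12 hq hB ∧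
    σ.sq1 h12 hq hB ∈ σ.pm1 h12 hq hB ∧ σ.tv2 h12 hq hB ∈ σ.pm2 h12 hq hB ∧ σ.sq2 h12 hq hB ∈ σ.pm2 h12 hq hB :=
  ⟨(HasLines.mkLine_ax _).1, (HasLines.mkLine_ax _).2, (HasLines.mkLine_ax _).1, (HasLines.mkLine_ax _).2, (HasLines.mkLine_ax _).1,
    (HasLines.mkLine_ax _).2⟩

/-! ### Base free points `P_t` and free base lines `B_s` -/

/-- `v1 ∈ σ^k M_1` -/
theorem tv1_mem_pow_pm1 (k : ℕ) : σ.tv1 h12 hq hB ∈ (σ.onLines ^ k) (σ.pm1 h12 hq hB) := by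
  have h := (σ.pow_mem_iff k (σ.tv1 h12 hq hB) (σ.pm1 h12 hq hB)).2 (σ.pm_mem h12 hq hB).2.2.1
  rwa [Equiv.Perm.pow_apply_eq_self_of_apply_eq_self (σ.tv_spec h12 hq hB).2.1 k] at h

/-- `v1 ∉ M_0` -/
theorem tv1_not_mem_pm0 : σ.tv1 h12 hq hB ∉ σ.pm0 h12 hq hB := fun h => by
  have e : σ.pm0 h12 hq hB = σ.sd2 h12 hq hB := (Nondegenerate.eq_or_eq (σ.pm_mem h12 hq hB).1 h
    (σ.tv_mem_sd h12 hq hB).2.2.2.2.1 (σ.tv_mem_sd h12 hq hB).2.2.2.2.2).resolve_left (σ.tv_spec h12 hq hB).2.2.2.1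
  have t := (σ.pm_mem h12 hq hB).2.1
  rw [e] at t
  exact (σ.sq0_spec h12 hq hB).2.1 (σ.eq_tv1_of_mem_sd0_sd2 h12 hq hB (σ.sq0_spec h12 hq hB).1 t)

/-- `M_0 ≠ σ^k M_1` -/
theorem pm0_ne_pow_pm1 (k : ℕ) : σ.pm0 h12 hq hB ≠ (σ.onLines ^ k) (σ.pm1 h12 hq hB) := fun h =>
  σ.tv1_not_mem_pm0 h12 hq hB (by rw [h]; exact σ.tv1_mem_pow_pm1 h12 hq hB k)

/-- **`P_t = M_0 ∩ σ^{−t} M_1`** -/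
noncomputable def fp11 (t : Fin 11) : P := HasPoints.mkPoint (σ.pm0_ne_pow_pm1 h12 hq hB ((-t : Fin 11) : ℕ))

/-- `P_t ∈ M_0` -/
theorem fp11_mem_pm0 (t : Fin 11) : σ.fp11 h12 hq hB t ∈ σ.pm0 h12 hq hB := (HasPoints.mkPoint_ax _).1

/-- `P_t ∈ σ^{−t} M_1` -/
theorem fp11_mem_pow_pm1 (t : Fin 11) : σ.fp11 h12 hq hB t ∈ (σ.onLines ^ ((-t : Fin 11) : ℕ)) (σ.pm1 h12 hq hB) :=
  (HasPoints.mkPoint_ax _).2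

/-- the lines through `Q_0` other than `S_0, M_0`: `11` of them -/
theorem card_fb11_subtype :
    Fintype.card {m : L // σ.sq0 h12 hq hB ∈ m ∧ m ≠ σ.sd0 h12 hq hB ∧ m ≠ σ.pm0 h12 hq hB} = 11 := by
  rw [Fintype.card_subtype]
  have h13 := card_lines_through (L := L) (σ.sq0 h12 hq hB)
  rw [h12] at h13
  have hset : (univ.filter fun m : L => σ.sq0 h12 hq hB ∈ m ∧ m ≠ σ.sd0 h12 hq hB ∧ m ≠ σ.pm0 h12 hq hB)
      = ((univ.filter fun m : L => σ.sq0 h12 hq hB ∈ m).erase (σ.sd0 h12 hq hB)).erase (σ.pm0 h12 hq hB) := by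
    ext m; simp only [mem_filter, mem_univ, true_and, mem_erase]; tauto
  have hm1 : σ.sd0 h12 hq hB ∈ univ.filter fun m : L => σ.sq0 h12 hq hB ∈ m := by simp [(σ.sq0_spec h12 hq hB).1]
  have hne : σ.pm0 h12 hq hB ≠ σ.sd0 h12 hq hB := fun h => σ.tv0_not_mem_sd0 h12 hq hB (h ▸ (σ.pm_mem h12 hq hB).1)
  have hm2 : σ.pm0 h12 hq hB ∈ (univ.filter fun m : L => σ.sq0 h12 hq hB ∈ m).erase (σ.sd0 h12 hq hB) := by
    rw [mem_erase]; exact ⟨hne, by simp [(σ.pm_mem h12 hq hB).2.1]⟩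
  rw [hset, card_erase_of_mem hm2, card_erase_of_mem hm1, h13]

/-- `Fin 11 ≃` the free lines through `Q_0` -/
noncomputable def efb11 : Fin 11 ≃ {m : L // σ.sq0 h12 hq hB ∈ m ∧ m ≠ σ.sd0 h12 hq hB ∧ m ≠ σ.pm0 h12 hq hB} :=
  (Fintype.equivFinOfCardEq (σ.card_fb11_subtype h12 hq hB)).symm

/-- **`B_s`**: the base line of free line orbit `s` (its line through `Q_0`) -/
noncomputable def fb11 (s : Fin 11) : L := (σ.efb11 h12 hq hB s).1

/-- `Q_0 ∈ B_s`, `B_s ≠ S_0`, `B_s ≠ M_0` -/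
theorem fb11_spec (s : Fin 11) : σ.sq0 h12 hq hB ∈ σ.fb11 h12 hq hB s ∧ σ.fb11 h12 hq hB s ≠ σ.sd0 h12 hq hB ∧
    σ.fb11 h12 hq hB s ≠ σ.pm0 h12 hq hB := (σ.efb11 h12 hq hB s).2

/-- `s ↦ B_s` is injective -/
theorem fb11_injective : Function.Injective (σ.fb11 h12 hq hB) := fun _ _ h => (σ.efb11 h12 hq hB).injective (Subtype.ext h)

/-! ### The exponents `phi`, `g1`, `g2` and the plane's `TriangleData 11` -/

/-- `phi t` as a natural number: SOME `x < 11` with `σ^x P_t ∈ M_2` (Hilbert epsilon; such an `x` exists and is unique —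
`OrderElevenTriangleLemmas.phiN11_spec`). -/
noncomputable def phiN11 (t : Fin 11) : ℕ :=
  Classical.epsilon fun x : ℕ => x < 11 ∧ (σ.onPoints ^ x) (σ.fp11 h12 hq hB t) ∈ σ.pm2 h12 hq hB

/-- `g1 s` as a natural number: SOME `x < 11` with `σ^x Q_1 ∈ B_s` (epsilon; exists and is unique). -/
noncomputable def g1N11 (s : Fin 11) : ℕ :=
  Classical.epsilon fun x : ℕ => x < 11 ∧ (σ.onPoints ^ x) (σ.sq1 h12 hq hB) ∈ σ.fb11 h12 hq hB s

/-- `g2 s` as a natural number: SOME `x < 11` with `σ^x Q_2 ∈ B_s` (epsilon; exists and is unique). -/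
noncomputable def g2N11 (s : Fin 11) : ℕ :=
  Classical.epsilon fun x : ℕ => x < 11 ∧ (σ.onPoints ^ x) (σ.sq2 h12 hq hB) ∈ σ.fb11 h12 hq hB s

/-- a natural number as a residue in `Fin 11` -/
def fin11 (x : ℕ) : Fin 11 := ⟨x % 11, Nat.mod_lt _ (by norm_num)⟩

omit σ in
/-- `fin11 x = x` for `x < 11` -/
theorem fin11_val_of_lt {x : ℕ} (hx : x < 11) : (fin11 x : ℕ) = x := Nat.mod_eq_of_lt hx

/-- **The plane's Case-B data** (`OrderElevenCollineation.TriangleData`): third-pencil positions `phi`, side positions `g1, g2` of the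
free base lines, and the membership table `mem s t x ↔ σ^x P_t ∈ B_s`. -/
noncomputable def triData11 : TriangleData 11 where
  phi := fun t => fin11 (σ.phiN11 h12 hq hB t)
  g1 := fun s => fin11 (σ.g1N11 h12 hq hB s)
  g2 := fun s => fin11 (σ.g2N11 h12 hq hB s)
  mem := fun s t x => decide ((σ.onPoints ^ (x : ℕ)) (σ.fp11 h12 hq hB t) ∈ σ.fb11 h12 hq hB s)

/-- unfolding `mem` -/
theorem triData11_mem (s t x : Fin 11) :
    (σ.triData11 h12 hq hB).mem s t x = true ↔ (σ.onPoints ^ (x : ℕ)) (σ.fp11 h12 hq hB t) ∈ σ.fb11 h12 hq hB s := by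
  simp [triData11]

/-- unfolding `phi` -/
theorem triData11_phi (t : Fin 11) : (σ.triData11 h12 hq hB).phi t = fin11 (σ.phiN11 h12 hq hB t) := rfl

/-- unfolding `g1` -/
theorem triData11_g1 (s : Fin 11) : (σ.triData11 h12 hq hB).g1 s = fin11 (σ.g1N11 h12 hq hB s) := rfl

/-- unfolding `g2` -/
theorem triData11_g2 (s : Fin 11) : (σ.triData11 h12 hq hB).g2 s = fin11 (σ.g2N11 h12 hq hB s) := rfl

end ElevenB

end Collineation

end Summit.Ventures.DiscreteObjects.PP12
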